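import Summits.Ventures.CertifiedManyBodySolver.Downfold.TPrimePinnedPairRowKernelPoly
import Summits.Ventures.CertifiedManyBodySolver.Rows.CorrWindowCertKernelChain
import HarnessLib

/-!
# The PINNED t′-PAIR shape from TWO STAGED (encoded merge CHAIN) kernel certificates sharing ONE equation-of-motion word list:
# `SquareTTPrimePinnedPairRowT.of_chainKernelCerts_tb` (cell `pub/hubbard-obs` × `pub/hubbard-downfold`, D-0154 (1)(C) COVERAGE La214;
# seat `hubbard-cov-la214-unc-2`, lineage desk; zero compute)

HONEST FRAMING: Lean plumbing towards «tier P» for PAIR claim nodes‴ — the T-shape twin of hubbard-cov-la214-box-2 g3's WN chain corollaries: per vertex,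
hubbard-obs-p2's staged replay (`Rows/CorrWindowCertKernelChain.lean`, p672734: `ChainOK Bkey M Cs (groupSlices (residTGslices … (gramTBslices K blocks) …) ns)`,
one `decide +kernel` per slice, two-level Gram PSD by construction) yields `evalPoly d (decPoly N C_M) = termOp d (residTG …)` (`evalPoly_chain_nil` +
`flatten_groupSlices` + `flatten_residTGslices` + `flatten_gramTBslices`/`termOp_gramTB_eq_gramForm`), which is the semantic-residual hypothesis of
`SquareTTPrimePinnedPairRowT.of_residPolys` (p673208). So a pinned pair of CHAIN-replayed vertex certificates with ONE shared `EB` IS the pair node‴ with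
NO further Lean: per vertex `(ns, M, Cs, hC0, hchain)` + the decidable price `β ≤ lowerConst (decPoly N C_M) + (μ 0 + μ 1)(n₀/2 − ν)`. Nothing is asserted: no
`def`, no named fact, no `sorry`, no number; no claim node is discharged (no chain of record exists yet); CONTROL / CALIBRATION wording class (xx1); no summit
statement is proved by this file.

References: J. Wang et al., PRX 14 (2024) 031006 §III [WangEtAl2024]; C. Jansson, D. Chaykin, C. Keil, SIAM J. Numer. Anal. 46 (2008) 180
[JanssonChaykinKeil2008]; D. P. Bertsekas, *Nonlinear Programming* (1999) Prop. 5.1.3 [Bertsekas1999NonlinearProgramming].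
-/

noncomputable section

namespace Summit.Ventures.CertifiedManyBodySolver.Downfold

open Literature.MathematicalPhysics.QuantumLattice
open Matrix HubbardWave0 Literature.Probability.LatticeModels ThermodynamicLimit Filter Topology
open Literature.MathematicalPhysics.QuantumManyBody.StateRelaxation
open Summit.Ventures.CertifiedQuantumChemistry Summit.Ventures.CertifiedQuantumChemistry.CARPoly
open Summit.Ventures.CertifiedManyBodySolver.CARPolyWindow
open scoped BigOperators ComplexOrder

/-! ## §1  TWO chain-replayed certificates (two-level Gram) with ONE shared eom word list ⇒ the pinned t′-pair shape -/

section KernelPairChain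

variable {β : Type*} {N : ℕ} [NeZero N]

/-- **KERNEL FORM OF THE PAIR NODE‴, STAGED (CHAIN) REPLAY, TWO-LEVEL GRAM.** As `SquareTTPrimePinnedPairRowT.of_residPolys` with each vertex's
residual polynomial supplied as the decoded END of hubbard-obs-p2's encoded merge chain over the slices of `residTG` (Gram family = the PSD-by-construction
two-level slices `gramTBslices K_v blocks_v`): per vertex the chain data `(ns_v, M_v, Cs_v)` with `Cs_v[0] = []`, `ChainOK Bkey M_v Cs_v (groupSlices … ns_v)`,
and the ONE decidable price `β_v ≤ lowerConst (decPoly N (Cs_v[M_v])) + (μ_v 0 + μ_v 1)(n₀/2 − ν_v)`; letters `Orb (Fin N)`.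
[cite: WangEtAl2024, §III] [cite: JanssonChaykinKeil2008, §3] [cite: Bertsekas1999NonlinearProgramming, Prop. 5.1.3] -/
theorem SquareTTPrimePinnedPairRowT.of_chainKernelCerts_tb
    (U : ℚ) (hU : 0 ≤ U) (n₀ : ℚ) (hn0 : 0 ≤ n₀) (hn2 : n₀ < 2) (sA sB : ℚ)
    {Λ : Finset (Site 2)} (hΛ : Λ ⊆ box 2 7) (h8 : thicken Λ 1 ⊆ box 2 7)
    (h0 : thicken ({0} : Finset (Site 2)) 1 ⊆ box 2 7) (hz : (0 : Site 2) ∈ box 2 7)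
    -- letters (shared)
    (d : Orb (Fin N) → Orb (PolySite (box 2 7))) (hd : Function.Injective d) (Bkey : ℕ)
    (dΛ : β → Orb (PolySite Λ)) (f : β → Orb (Fin N)) (hf : ∀ b, d (f b) = Orb.embMap (PolySite.incl hΛ) (dΛ b))
    (sp : Orb (Fin N) → Fin 2) (hsp : ∀ a, (ofLex (d a)).2 = sp a)
    (o : Fin 2 → Orb (Fin N)) (ho : ∀ σ, d (o σ) = orb (PolySite.pt 0 hz) σ)
    -- the objective family and the SHARED eom words
    (X : ℝ → FermionOp (box 2 7)) (EB : List (Terms β))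
    -- vertex A
    (THA : Terms (Orb (Fin N))) (hHA : termOp d THA = (hubbardTTPrimeFermionInteraction 1 (sA : ℝ) (U : ℝ)).localHamiltonian (box 2 7))
    (TEA : Terms (Orb (Fin N)))
    (hEA : termOp d TEA = fermionEmbed (PolySite.incl h0) ((hubbardTTPrimeFermionInteraction 1 (sA : ℝ) (U : ℝ)).meanEnergyObs 1))
    (TXA : Terms (Orb (Fin N))) (hXA : termOp d TXA = X (sA : ℝ)) (μA : Fin 2 → ℚ) (νA κA capA κA' flA : ℚ)
    (KA : ℕ) (blocksA : List (List (List ℤ × Terms (Orb (Fin N)))))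
    {nSA : ℕ} (γA : Fin nSA → DihedralGroup 4) (wvA : Fin nSA → Site 2) (hshA : ∀ l, d4ShiftSet (γA l) (wvA l) Λ ⊆ box 2 7)
    (gA : Fin nSA → β → Orb (Fin N))
    (hgA : ∀ l b, d (gA l b) = Orb.embMap (PolySite.incl (hshA l)) (Orb.embMap (PolySite.d4Emb (γA l) (wvA l) Λ) (dΛ b)))
    (SYA : Fin nSA → Terms β) (CWA : Terms (Orb (Fin N))) (hcwA : ∀ wc ∈ CWA, chargeW wc.1 ≠ 0 ∨ spinChargeW sp wc.1 ≠ 0)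
    (AVA : List (Terms (Orb (Fin N))))
    (nsA : List ℕ) (MA : ℕ) (CsA : List SOSDual.EncPoly) (hC0A : CsA.getD 0 [] = [])
    (hchainA : ChainOK Bkey MA CsA
      (groupSlices (residTGslices TXA μA νA o κA capA κA' flA TEA (gramTBslices KA blocksA) THA f EB gA SYA CWA AVA) nsA))
    {βA : ℚ} (hβA : βA ≤ lowerConst (SOSDual.decPoly N (CsA.getD MA [])) + (μA 0 + μA 1) * (n₀ / 2 - νA))
    -- vertex B
    (THB : Terms (Orb (Fin N))) (hHB : termOp d THB = (hubbardTTPrimeFermionInteraction 1 (sB : ℝ) (U : ℝ)).localHamiltonian (box 2 7))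
    (TEB : Terms (Orb (Fin N)))
    (hEB : termOp d TEB = fermionEmbed (PolySite.incl h0) ((hubbardTTPrimeFermionInteraction 1 (sB : ℝ) (U : ℝ)).meanEnergyObs 1))
    (TXB : Terms (Orb (Fin N))) (hXB : termOp d TXB = X (sB : ℝ)) (μB : Fin 2 → ℚ) (νB κB capB κB' flB : ℚ)
    (KB : ℕ) (blocksB : List (List (List ℤ × Terms (Orb (Fin N)))))
    {nSB : ℕ} (γB : Fin nSB → DihedralGroup 4) (wvB : Fin nSB → Site 2) (hshB : ∀ l, d4ShiftSet (γB l) (wvB l) Λ ⊆ box 2 7)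
    (gB : Fin nSB → β → Orb (Fin N))
    (hgB : ∀ l b, d (gB l b) = Orb.embMap (PolySite.incl (hshB l)) (Orb.embMap (PolySite.d4Emb (γB l) (wvB l) Λ) (dΛ b)))
    (SYB : Fin nSB → Terms β) (CWB : Terms (Orb (Fin N))) (hcwB : ∀ wc ∈ CWB, chargeW wc.1 ≠ 0 ∨ spinChargeW sp wc.1 ≠ 0)
    (AVB : List (Terms (Orb (Fin N))))
    (nsB : List ℕ) (MB : ℕ) (CsB : List SOSDual.EncPoly) (hC0B : CsB.getD 0 [] = [])
    (hchainB : ChainOK Bkey MB CsB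
      (groupSlices (residTGslices TXB μB νB o κB capB κB' flB TEB (gramTBslices KB blocksB) THB f EB gB SYB CWB AVB) nsB))
    {βB : ℚ} (hβB : βB ≤ lowerConst (SOSDual.decPoly N (CsB.getD MB [])) + (μB 0 + μB 1) * (n₀ / 2 - νB)) :
    SquareTTPrimePinnedPairRowT (U : ℝ) (n₀ : ℝ) (sA : ℝ) (sB : ℝ) capA capB flA flB βA κA κA' βB κB κB' X := by
  -- per vertex: the chain's decoded end denotes the residual; the two-level Gram slices denote a PSD `gramForm`
  have hTGA : termOp d (gramTBslices KA blocksA).flatten = gramForm (gramTBCoef KA blocksA) (gramTBOp d blocksA) := by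
    rw [flatten_gramTBslices, termOp_gramTB_eq_gramForm]
  have hTGB : termOp d (gramTBslices KB blocksB).flatten = gramForm (gramTBCoef KB blocksB) (gramTBOp d blocksB) := by
    rw [flatten_gramTBslices, termOp_gramTB_eq_gramForm]
  have hRA : evalPoly d (SOSDual.decPoly N (CsA.getD MA [])) =
      termOp d (residTG TXA μA νA o κA capA κA' flA TEA (gramTBslices KA blocksA).flatten THA f EB gA SYA CWA AVA) := by
    rw [evalPoly_chain_nil hd hC0A hchainA, flatten_groupSlices, flatten_residTGslices]
  have hRB : evalPoly d (SOSDual.decPoly N (CsB.getD MB [])) =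
      termOp d (residTG TXB μB νB o κB capB κB' flB TEB (gramTBslices KB blocksB).flatten THB f EB gB SYB CWB AVB) := by
    rw [evalPoly_chain_nil hd hC0B hchainB, flatten_groupSlices, flatten_residTGslices]
  exact SquareTTPrimePinnedPairRowT.of_residPolys U hU n₀ hn0 hn2 sA sB hΛ h8 h0 hz d dΛ f hf sp hsp o ho X EB
    THA hHA TEA hEA TXA hXA μA νA κA capA κA' flA (gramTBslices KA blocksA).flatten (gramTBCoef_posSemidef KA blocksA)
    (gramTBOp d blocksA) hTGA γA wvA hshA gA hgA SYA CWA hcwA AVA hRA hβA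
    THB hHB TEB hEB TXB hXB μB νB κB capB κB' flB (gramTBslices KB blocksB).flatten (gramTBCoef_posSemidef KB blocksB)
    (gramTBOp d blocksB) hTGB γB wvB hshB gB hgB SYB CWB hcwB AVB hRB hβB

end KernelPairChain

end Summit.Ventures.CertifiedManyBodySolver.Downfold

end
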